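import Summits.Schanuel.Schanuel.Theorems.ZilberEacBranchChartCoefficient
import Summits.Schanuel.Schanuel.Theorems.ZilberEacBranchRamifiedTrichotomy
import HarnessLib

/-!
# Arbitrary base branches, XV: EQUAL POLE ORDERS WITH A NON-REAL ASYMPTOTIC DIRECTION — density
# by growth alone

HONEST FRAMING.  Cell `pub-schanuel` (Zilber's Exponential-Algebraic Closedness, case ladder;
host summit Schanuel), seat 2, gen 28.  Files I–XIII treat base branches along which the second
additive coordinate grows FASTER than the label coordinate (`x₀ = s^{-k}`, `x₁ = Φ(s)s^{-M}`,
`M ≥ k + 1`).  When the pole orders are EQUAL (`M = k`, i.e. `x₁/x₀ → Φ(0) ∈ ℂˣ`: the base curve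
has the asymptotic direction `[1 : Φ(0) : 0]`), the phase polynomial of the witness has degree `k`
and leading coefficient `Φ(0)·m′(0)^k = 2πi·Φ(0)` (file XIV), so `Re Π` has leading coefficient
`−2π·Im Φ(0)`.  If the direction is NON-REAL (`Im Φ(0) ≠ 0`), `|Re x₁|` grows polynomially along the
exponential points of the cylinder germ while `log ‖x₁‖` grows logarithmically, and THEOREM G alone
gives density — no fibre relation, no zero branch, no transcendence step:
**`unprojectedDense_branch_growth_of_re_ne_zero`** (any `k, M ≥ 1`: dense whenever
`Re(Φ(0)·z^M) ≠ 0` for every `k`-th root `z` of `2πi` — this also covers GENERIC directions when the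
second coordinate grows SLOWER, `M < k`) and its case `M = k`,
**`unprojectedDense_branch_equalOrder_of_im_ne_zero`** — `S ⊆ ℂ² × ℂ²` irreducible closed of
dimension `≤ 2` containing the cylinder germ `(s^{-k}, Φ(s)s^{-k}, ψ(s), e^{Φ(s)s^{-k}})`
(`k ≥ 1`, `ψ(0) ≠ 0`, `Im Φ(0) ≠ 0`) has `I(S ∩ Γ_exp) = I(S)`.
This covers, e.g., every graph fibre with nonzero finite limit over the complex CIRCLE
`x₀² + x₁² = 1` (directions `±i`), over every conic or Fermat curve `x₀ⁿ + x₁ⁿ = 1` (`n ≥ 2`) along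
a branch with non-real `n`-th root of `−1`, and over every curve with a non-real asymptotic
direction (file XVI: the circle).  The REAL-irrational directions (`Im Φ(0) = 0`, `Φ(0) ∉ ℚ`: the
straight real line `x₁ = √2x₀` and its relatives) remain OPEN.  Decided instances of an OPEN question
(Mantova–Masser, PLMS 2024 §1 p. 5); EC(3,2) OPEN; NOT Schanuel's conjecture (neither used nor
implied); EAC ⇏ SC.
-/

noncomputable section

open Filter Topology Polynomial MvPolynomial Bornology Complex
open Literature.NumberTheory.Transcendental Literature.ModelTheory.Zilber
open Literature.ModelTheory.ExponentialFields

set_option linter.dupNamespace false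

namespace Summit.Schanuel.Schanuel.Theorems

/-- The real-part polynomial of `exists_re_im_polynomials` has degree `≥ k` as soon as
`Re(Π_k) ≠ 0`. [folklore] -/
theorem le_natDegree_rePoly {Q : ℂ[X]} {gR : ℝ[X]} (hgR : ∀ x : ℝ, (Q.eval (x : ℂ)).re = gR.eval x)
    {k : ℕ} (hk : (Q.coeff k).re ≠ 0) : k ≤ gR.natDegree := by
  classical
  set n := Q.natDegree + 1 with hn
  set G₂ : ℝ[X] := ∑ j ∈ Finset.range n, Polynomial.monomial j (Q.coeff j).re with hG₂
  have hG₂ev : ∀ x : ℝ, (Q.eval (x : ℂ)).re = G₂.eval x := by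
    intro x
    rw [Polynomial.eval_eq_sum_range, Complex.re_sum, hG₂, Polynomial.eval_finsetSum]
    refine Finset.sum_congr rfl fun j _ => ?_
    rw [Polynomial.eval_monomial, ← Complex.ofReal_pow, Complex.re_mul_ofReal]
  have heq : gR = G₂ := Polynomial.funext fun x => by rw [← hgR x, hG₂ev x]
  have hkQ : k < n := by
    have : Q.coeff k ≠ 0 := fun h => hk (by rw [h, Complex.zero_re])
    exact Nat.lt_succ_of_le (Polynomial.le_natDegree_of_ne_zero this)
  have hcoeff : gR.coeff k = (Q.coeff k).re := by
    rw [heq, hG₂, Polynomial.finsetSum_coeff]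
    simp only [Polynomial.coeff_monomial, Finset.sum_ite_eq', Finset.mem_range, if_pos hkQ]
  exact Polynomial.le_natDegree_of_ne_zero (by rw [hcoeff]; exact hk)

/-- **Growth from the direction alone.**  A cylinder germ `(s^{-k}, Φ(s)s^{-M}, ψ(s), e^{x₁})`
(`k, M ≥ 1` — ANY relative size of the pole orders) in an irreducible closed `S` of dimension `≤ 2`,
with `ψ(0) ≠ 0` and `Re(Φ(0)·z^M) ≠ 0` for every `k`-th root `z` of `2πi` (the possible values of
`m′(0)`), gives Zariski-dense exponential points: the phase polynomial has degree `M` with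
`Re Π_M ≠ 0`, so THEOREM G applies.
[cite: MantovaMasser2023, §1 Further remarks, p. 5 (the question, open in general)] (new) -/
theorem unprojectedDense_branch_growth_of_re_ne_zero {S : Set (Fin 2 ⊕ Fin 2 → ℂ)}
    (hS : IsIrreducibleClosed ℂ S) (hdim : zariskiDim ℂ S ≤ (2 : ℕ))
    {k M : ℕ} (hk : 1 ≤ k) (hM : 1 ≤ M) {ψ : ℂ → ℂ} (hψ : AnalyticAt ℂ ψ 0) {θ : ℂ} (hθ0 : θ ≠ 0)
    (hψ0 : ψ 0 = θ) {Φ : ℂ → ℂ} (hΦ : AnalyticAt ℂ Φ 0)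
    (hdir : ∀ z : ℂ, z ^ k = 2 * Real.pi * I → (Φ 0 * z ^ M).re ≠ 0)
    (hgerm : ∀ᶠ s in 𝓝[≠] (0 : ℂ),
      (Sum.elim ![(s ^ k)⁻¹, Φ s * (s ^ M)⁻¹] ![ψ s, Complex.exp (Φ s * (s ^ M)⁻¹)] :
        Fin 2 ⊕ Fin 2 → ℂ) ∈ S) :
    UnprojectedDense S := by
  classical
  -- `θ = e^τ`; chart; witness
  set τ : ℂ := Complex.log θ with hτdef
  have hτ : Complex.exp τ = θ := Complex.exp_log hθ0
  obtain ⟨m, hman, hm0, hm', hchart⟩ := exists_ramifiedChart hψ hθ0 hψ0 τ hk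
  obtain ⟨U, r, Pl, m₀, μ, σ, hUan, -, hran, hPldeg, hPlM, hside, hμ0, hμ, -, hGσ, hxU, hexpσ, hnorm,
      -, hid₁⟩ :=
    exists_ramified_witness_branch hθ0 hτ hk hgerm hman hm0 hm' hchart hΦ M
  -- the chart constant and the leading coefficient `Π_M = Φ(0)·m′(0)^M`
  have hmk : deriv m 0 ^ k = 2 * Real.pi * I := deriv_chart_pow_eq hψ hθ0 hψ0 hk hman hm0 hchart
  have hmne : ∀ᶠ s in 𝓝[≠] (0 : ℂ), m s ≠ 0 := by
    refine eventually_nhdsWithin_iff.2 ?_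
    filter_upwards [hchart] with s hs hs0 using (hs.2.2.2.2 hs0).1
  have hcoeff : Pl.coeff M = Φ 0 * deriv m 0 ^ M :=
    laurentPart_coeff_eq hman hm0 hmne hΦ hM hPldeg hran (hside.mono fun s h => h.2)
  have hre : (Pl.coeff M).re ≠ 0 := by
    rw [hcoeff]
    exact hdir _ hmk
  -- the points
  set q : ℕ → Fin 2 ⊕ Fin 2 → ℂ := fun j =>
    Sum.elim ![(σ j ^ k)⁻¹, Φ (σ j) * (σ j ^ M)⁻¹]
      ![ψ (σ j), Complex.exp (Φ (σ j) * (σ j ^ M)⁻¹)] with hq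
  have hqS : ∀ j, q j ∈ S := fun j => hGσ j
  have hqΓ : ∀ j, q j ∈ expGraph ℂ 2 := by
    intro j
    rw [mem_expGraph_iff]
    intro i
    rw [Literature.ModelTheory.ExponentialFields.ExponentialRing.complex_exp_eq]
    fin_cases i
    · simp [hq, hexpσ j]
    · simp [hq]
  have hid : ∀ j, q j (Sum.inl 1) = Pl.eval ((m₀ + j : ℕ) : ℂ) + r (μ j) := fun j => by
    simp only [hq, Sum.elim_inl, Matrix.cons_val_one, Matrix.cons_val_zero]
    exact hid₁ j
  -- GROWTH (the growth branch of file II, verbatim)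
  obtain ⟨gR, gI, hgR, -⟩ := exists_re_im_polynomials Pl
  have hgRdeg : 1 ≤ gR.natDegree := le_trans hM (le_natDegree_rePoly hgR hre)
  have hcast : ∀ j, ((m₀ + j : ℕ) : ℂ) = (((m₀ + j : ℕ) : ℝ) : ℂ) := fun j => by
    rw [Complex.ofReal_natCast]
  have hrlim : Tendsto (fun j => r (μ j)) atTop (𝓝 (r 0)) := hran.continuousAt.tendsto.comp hμ
  have hreq : ∀ j, (q j (Sum.inl 1)).re = gR.eval ((m₀ + j : ℕ) : ℝ) + (r (μ j)).re := by
    intro j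
    rw [hid j, Complex.add_re, hcast, hgR]
  obtain ⟨M, hM⟩ : ∃ M : ℝ, ∀ j, ‖r (μ j)‖ ≤ M := by
    obtain ⟨C, hC⟩ := isBounded_iff_forall_norm_le.1 (Metric.isBounded_range_of_tendsto _ hrlim)
    exact ⟨C, fun j => hC _ ⟨j, rfl⟩⟩
  have hM0 : 0 ≤ M := (norm_nonneg _).trans (hM 0)
  have ha : ∀ j, |(q j (Sum.inl 1)).re - gR.eval ((m₀ + j : ℕ) : ℝ)| ≤ M := by
    intro j
    rw [hreq j, add_sub_cancel_left]
    exact (Complex.abs_re_le_norm _).trans (hM j)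
  obtain ⟨D, hD, hLD⟩ := log_two_add_norm_eval_le_log_label Pl (le_refl (0 : ℝ))
  have hLD' : ∀ j, Real.log (2 + ‖q j (Sum.inl 1)‖) ≤
      (D + Real.log (1 + M)) * Real.log (3 + 3 * ((m₀ + j : ℕ) : ℝ)) := by
    intro j
    have hlab0 : (0 : ℝ) ≤ ((m₀ + j : ℕ) : ℝ) := Nat.cast_nonneg _
    have h1 : Real.log (2 + ‖Pl.eval ((m₀ + j : ℕ) : ℂ)‖) ≤
        D * Real.log (3 + 3 * ((m₀ + j : ℕ) : ℝ)) := by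
      refine hLD _ _ hlab0 ?_
      rw [Complex.norm_natCast, zero_add]
      linarith
    have h2 : ‖q j (Sum.inl 1)‖ ≤ ‖Pl.eval ((m₀ + j : ℕ) : ℂ)‖ + M := by
      rw [hid j]
      exact (norm_add_le _ _).trans (by linarith [hM j])
    calc Real.log (2 + ‖q j (Sum.inl 1)‖)
        ≤ Real.log (2 + ‖Pl.eval ((m₀ + j : ℕ) : ℂ)‖ + M) :=
          Real.log_le_log (by positivity) (by linarith)
      _ ≤ (D + Real.log (1 + M)) * Real.log (3 + 3 * ((m₀ + j : ℕ) : ℝ)) :=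
          log_two_add_add_le (norm_nonneg _) hM0 (one_le_log_three_add _ hlab0) h1
  have hD' : 0 < D + Real.log (1 + M) := by
    have := Real.log_nonneg (by linarith : (1 : ℝ) ≤ 1 + M)
    linarith
  have hgr : Tendsto (fun j => |(q j (Sum.inl 1)).re| / Real.log (2 + ‖q j (Sum.inl 1)‖))
      atTop atTop :=
    tendsto_abs_div_log_of_linear_growth hgRdeg m₀ hD' ha
      (fun j => Real.log_le_log two_pos (by linarith [norm_nonneg (q j (Sum.inl 1))])) hLD'
  exact unprojectedDense_of_growth hS hdim 1 hqS hqΓ hgr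


/-- **Equal pole orders with a non-real asymptotic direction ⟹ dense (growth alone).**  The case
`M = k` of `unprojectedDense_branch_growth_of_re_ne_zero`: for a `k`-th root `z` of `2πi`,
`Re(Φ(0)·z^k) = Re(2πi·Φ(0)) = −2π·Im Φ(0)`.  See the module docstring.
[cite: MantovaMasser2023, §1 Further remarks, p. 5 (the question, open in general)] (new) -/
theorem unprojectedDense_branch_equalOrder_of_im_ne_zero {S : Set (Fin 2 ⊕ Fin 2 → ℂ)}
    (hS : IsIrreducibleClosed ℂ S) (hdim : zariskiDim ℂ S ≤ (2 : ℕ))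
    {k : ℕ} (hk : 1 ≤ k) {ψ : ℂ → ℂ} (hψ : AnalyticAt ℂ ψ 0) {θ : ℂ} (hθ0 : θ ≠ 0) (hψ0 : ψ 0 = θ)
    {Φ : ℂ → ℂ} (hΦ : AnalyticAt ℂ Φ 0) (hΦim : (Φ 0).im ≠ 0)
    (hgerm : ∀ᶠ s in 𝓝[≠] (0 : ℂ),
      (Sum.elim ![(s ^ k)⁻¹, Φ s * (s ^ k)⁻¹] ![ψ s, Complex.exp (Φ s * (s ^ k)⁻¹)] :
        Fin 2 ⊕ Fin 2 → ℂ) ∈ S) :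
    UnprojectedDense S := by
  refine unprojectedDense_branch_growth_of_re_ne_zero hS hdim hk hk hψ hθ0 hψ0 hΦ (fun z hz => ?_) hgerm
  rw [hz]
  have e : (Φ 0 * (2 * Real.pi * I)).re = -(2 * Real.pi) * (Φ 0).im := by
    simp [Complex.mul_re, Complex.mul_im]; ring
  rw [e]
  exact mul_ne_zero (neg_ne_zero.2 (by positivity)) hΦim

end Summit.Schanuel.Schanuel.Theorems
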